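import Summits.ResolutionOfSingularities.ResolutionOfSingularities.Theorems.ExitLawStates
import Summits.ResolutionOfSingularities.ResolutionOfSingularities.Theorems.ProximityCutClasses
import HarnessLib

/-!
# ExitLawWalks — §3 of the decomp-res node «ExitLaw» (lens-5 g15, sha256 fd5076a831344d35; critic row 119 CLEARED)

Tree file 2/4: the exit law along forced walks (three variables, walks from a root, every `q`, every field) —
`not_staysOnNewest_of_order_eq`, `leavesNewest_of_order_eq`, `order_gt_of_staysOnNewest`, `satellite_of_staysOnNewest`,
ABSORPTION `absorb`, the EXCESS LEDGER `excess_ledger`, `frozen_tail`, `leaves_of_frozen`, `frozen_recipe`,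
`no_frozen_two_components` — VERBATIM from the lens file.
[WRITER NOTE (decomp-res writer g5): the letters `LeavesNewest` / `StaysOnNewest` / `leavesNewest_iff_not_stays` are the
tree's (`ProximityCutClasses`, lens-3 g12) — the lens's verbatim restatements are deleted and `ProximityCut` is opened;
the local `NoJump.r_succ_chart` (≡ tree `NoJump.r_succ_chart`) is deleted and cited by name (critic row 119 r1).]
(Sources: Hauser2010 §§F–G; CossartPiltant2019; CossartJannsenSaito2020.)
-/

open MvPolynomial Finset
open scoped BigOperators
open Literature.AlgebraicGeometry.Resolution
open Literature.AlgebraicGeometry.Resolution.Hauser2010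
open Literature.AlgebraicGeometry.Resolution.PointBlowup
open Literature.AlgebraicGeometry.Resolution.WeightedBlowup
open Literature.Barriers.ResolutionOfSingularities
open Summit.ResolutionOfSingularities.ResolutionOfSingularities.Theorems.TightDefectClasses
open Summit.ResolutionOfSingularities.ResolutionOfSingularities.Theorems.TightDefectStrongWalks
open Summit.ResolutionOfSingularities.ResolutionOfSingularities.Theorems.ItineraryCutClasses
open Summit.ResolutionOfSingularities.ResolutionOfSingularities.Theorems.BoundaryLedger
open Summit.ResolutionOfSingularities.ResolutionOfSingularities.Theorems.ProximityCut

namespace Summit.ResolutionOfSingularities.ResolutionOfSingularities.Theorems.ExitLaw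

/-! ## §3 The exit law along forced walks (three variables, walks from a root, every `q`, every field) -/

section Walks

variable {K : Type} [Field K] [DecidableEq K] {q : ℕ} {s₀ : State (Fin 3) K}

/-- **THE EXIT LAW ALONG A WALK (PROVED).**  Along a forced walk from a root, a state of order EXACTLY `q` is never
followed by a proximity repeat: the centre after it leaves the divisor it creates. [new] [folklore] -/
theorem not_staysOnNewest_of_order_eq (hroot : IsRoot q s₀) (W : ForcedWalk q s₀) (t : ℕ)
    (ho : ordZero (W.st t).F = (q : ℕ∞)) : ¬ StaysOnNewest W t := by
  rintro ⟨hj, hb⟩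
  have h := not_isEquimultiplePoint_after_order_eq q (W.st t) (walk_clean hroot W t) ho (W.j t) (W.b t)
    (W.onExc t) (W.equimult t) hj (W.b (t + 1)) (W.onExc (t + 1)) hb
  rw [← W.st_succ] at h
  exact h (W.equimult (t + 1))

/-- … positively: order `q` at time `t` forces the letter `F` (newest-free) at move `t+1`. [new] [folklore] -/
theorem leavesNewest_of_order_eq (hroot : IsRoot q s₀) (W : ForcedWalk q s₀) (t : ℕ)
    (ho : ordZero (W.st t).F = (q : ℕ∞)) : LeavesNewest W t :=
  (leavesNewest_iff_not_stays W t).mpr (not_staysOnNewest_of_order_eq hroot W t ho)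

/-- … contrapositive in the order: a proximity repeat at move `t+1` needs POSITIVE EXCESS `o_t ≥ q + 1`. [new] [folklore] -/
theorem order_gt_of_staysOnNewest (hroot : IsRoot q s₀) (W : ForcedWalk q s₀) (t : ℕ) (hS : StaysOnNewest W t) :
    ∃ o : ℕ, ordZero (W.st t).F = o ∧ q < o := by
  obtain ⟨o, ho, hqo⟩ := walk_nat hroot W t
  rcases hqo.lt_or_eq with hlt | heq
  · exact ⟨o, ho, hlt⟩
  · exact absurd hS (not_staysOnNewest_of_order_eq hroot W t (by rw [ho, heq]))

/-- **EVERY PROXIMITY REPEAT IS A SATELLITE MOVE (PROVED)** — there are no massless repeats: the repeat keeps the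
just-created component, which carries the mass `o_t − q ≥ 1` by the exit law. [new] [folklore] -/
theorem satellite_of_staysOnNewest (hroot : IsRoot q s₀) (W : ForcedWalk q s₀) (t : ℕ) (hS : StaysOnNewest W t) :
    W.Satellite (t + 1) := by
  obtain ⟨o, ho, hlt⟩ := order_gt_of_staysOnNewest hroot W t hS
  refine ⟨W.j t, Ne.symm hS.1, hS.2, ?_⟩
  rw [NoJump.r_succ_chart W t ho]
  omega

/-! ### Absorption: on a plateau, order `q` is a trap -/

/-- The kept part is below the boundary. [folklore] -/
theorem kept_le (W : ForcedWalk q s₀) (t : ℕ) : kept W t ≤ (W.st t).r := by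
  classical
  refine Finsupp.le_def.mpr fun i => ?_
  rw [kept_apply]
  split_ifs
  · exact le_rfl
  · exact Nat.zero_le _

/-- **ABSORPTION (PROVED).**  If the order is `q` at time `t` and the shade does not move at move `t+1`, then the
order is `q` again at time `t+1`, the move kept the whole boundary and created a massless component:
`r_{t+1} = r_t`.  (`o = s + |r|` on both sides, `|r_{t+1}| = |kept_t| ≤ |r_t|`, `o_{t+1} ≥ q`.) [new] [folklore] -/
theorem absorb (hroot : IsRoot q s₀) (W : ForcedWalk q s₀) (t : ℕ) (ho : ordZero (W.st t).F = (q : ℕ∞))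
    (hplat : (W.st (t + 1)).shade = (W.st t).shade) :
    ordZero (W.st (t + 1)).F = (q : ℕ∞) ∧ (W.st (t + 1)).r = (W.st t).r := by
  classical
  obtain ⟨s, hs, hqs⟩ := order_eq_shade_add_degree hroot W t ho
  obtain ⟨o', ho', hqo'⟩ := walk_nat hroot W (t + 1)
  obtain ⟨s', hs', hos'⟩ := order_eq_shade_add_degree hroot W (t + 1) ho'
  have hss : s' = s := by
    have h := hplat
    rw [hs, hs'] at h
    exact_mod_cast h
  have hdeg := degree_r_succ W t ho
  rw [Nat.sub_self, add_zero] at hdeg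
  have hkle := degree_le_degree_of_le (kept_le W t)
  have ho'q : o' = q := by omega
  refine ⟨by rw [ho', ho'q], ?_⟩
  have hk : kept W t = (W.st t).r := eq_of_le_of_degree_le (kept_le W t) (by omega)
  rw [r_succ_eq W t ho, Nat.sub_self, Finsupp.single_zero, add_zero, hk]

/-- **THE EXCESS LEDGER ON A PLATEAU (PROVED)**: `o_{t+1} + |r_t| + q = 2·o_t + |kept_t|`, i.e. with the excess
`m = o − q` and the lost mass `λ_t = |r_t| − |kept_t| ≥ 0`: `m_{t+1} = 2·m_t − λ_t` — a total-keep move DOUBLES the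
excess, a free move lowers it by `q − s`; absorption is the case `m_t = 0`. [new] [folklore] -/
theorem excess_ledger (hroot : IsRoot q s₀) (W : ForcedWalk q s₀) (t : ℕ) {o o' : ℕ}
    (ho : ordZero (W.st t).F = o) (ho' : ordZero (W.st (t + 1)).F = o')
    (hplat : (W.st (t + 1)).shade = (W.st t).shade) :
    o' + (W.st t).r.degree + q = 2 * o + (kept W t).degree := by
  obtain ⟨s, hs, hos⟩ := order_eq_shade_add_degree hroot W t ho
  obtain ⟨s', hs', hos'⟩ := order_eq_shade_add_degree hroot W (t + 1) ho'
  have hss : s' = s := by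
    have h := hplat
    rw [hs, hs'] at h
    exact_mod_cast h
  obtain ⟨o₁, ho₁, hq⟩ := walk_nat hroot W t
  have hoo : o₁ = o := by
    have h := ho₁.symm.trans ho
    exact_mod_cast h
  have hdeg := degree_r_succ W t ho
  omega

/-- **FROZEN TAILS (PROVED).**  On a plateau (shade constant from `N` on), once the order is `q` it stays `q` and the
boundary vector freezes. [new] [folklore] -/
theorem frozen_tail (hroot : IsRoot q s₀) (W : ForcedWalk q s₀) {N t₀ : ℕ} (hN : N ≤ t₀)
    (hplat : ∀ t, N ≤ t → (W.st (t + 1)).shade = (W.st t).shade) (ho : ordZero (W.st t₀).F = (q : ℕ∞)) :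
    ∀ t, t₀ ≤ t → ordZero (W.st t).F = (q : ℕ∞) ∧ (W.st t).r = (W.st t₀).r := by
  intro t ht
  induction t, ht using Nat.le_induction with
  | base => exact ⟨ho, rfl⟩
  | succ t ht ih =>
    obtain ⟨h1, h2⟩ := absorb hroot W t ih.1 (hplat t (by omega))
    exact ⟨h1, h2.trans ih.2⟩

/-- **FROZEN PLATEAUX ARE NEWEST-FREE (PROVED)** — the bridge from the base range of the excess axis to the ARC LAW:
on a plateau, from the first time of order `q` on, every move leaves the divisor just created. [new] [folklore] -/
theorem leaves_of_frozen (hroot : IsRoot q s₀) (W : ForcedWalk q s₀) {N t₀ : ℕ} (hN : N ≤ t₀)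
    (hplat : ∀ t, N ≤ t → (W.st (t + 1)).shade = (W.st t).shade) (ho : ordZero (W.st t₀).F = (q : ℕ∞)) :
    ∀ t, t₀ ≤ t → LeavesNewest W t :=
  fun t ht => leavesNewest_of_order_eq hroot W t (frozen_tail hroot W hN hplat ho t ht).1

/-- On a frozen tail every move keeps the whole boundary: the chart avoids the loaded components and the centre
lies on all of them. [new] [folklore] -/
theorem frozen_recipe (hroot : IsRoot q s₀) (W : ForcedWalk q s₀) (t : ℕ) (ho : ordZero (W.st t).F = (q : ℕ∞))
    (hplat : (W.st (t + 1)).shade = (W.st t).shade) {i : Fin 3} (hi : 0 < (W.st t).r i) :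
    W.j t ≠ i ∧ W.b t i = 0 := by
  classical
  obtain ⟨s, hs, hqs⟩ := order_eq_shade_add_degree hroot W t ho
  obtain ⟨-, hr⟩ := absorb hroot W t ho hplat
  have hdeg := degree_r_succ W t ho
  rw [Nat.sub_self, add_zero, hr] at hdeg
  have hk : kept W t = (W.st t).r := eq_of_le_of_degree_le (kept_le W t) (by omega)
  have hki := congrArg (fun f : Fin 3 →₀ ℕ => f i) hk
  simp only [kept_apply] at hki
  by_cases hc : i ≠ W.j t ∧ W.b t i = 0
  · exact ⟨Ne.symm hc.1, hc.2⟩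
  · rw [if_neg hc] at hki
    omega

/-- Three indices: avoiding two distinct ones pins the third. [folklore] -/
theorem fin3_eq_of_ne_of_ne {a c k k' : Fin 3} (hac : a ≠ c) (hka : k ≠ a) (hkc : k ≠ c) (hk'a : k' ≠ a)
    (hk'c : k' ≠ c) : k' = k := by
  revert a c k k'
  decide

/-- Three indices: two distinct ones and one avoiding both exhaust `Fin 3`. [folklore] -/
theorem fin3_cases {a c k : Fin 3} (hac : a ≠ c) (hka : k ≠ a) (hkc : k ≠ c) (i : Fin 3) :
    i = a ∨ i = c ∨ i = k := by
  revert a c k i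
  decide

/-- **TWO-COMPONENT FROZEN PLATEAUX DO NOT EXIST (PROVED outright, port-free)**: a frozen tail keeping TWO loaded
components has the constant corner recipe `(k, 0)` and is an axis tail, excluded by the tree's `no_axis_tail`. [new]
[folklore] -/
theorem no_frozen_two_components (hroot : IsRoot q s₀) (W : ForcedWalk q s₀) {N t₀ : ℕ} (hN : N ≤ t₀)
    (hplat : ∀ t, N ≤ t → (W.st (t + 1)).shade = (W.st t).shade) (ho : ordZero (W.st t₀).F = (q : ℕ∞))
    {a c : Fin 3} (hac : a ≠ c) (ha : 0 < (W.st t₀).r a) (hc : 0 < (W.st t₀).r c) : False := by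
  have hrec : ∀ t, t₀ ≤ t → W.j t ≠ a ∧ W.j t ≠ c ∧ W.b t a = 0 ∧ W.b t c = 0 := by
    intro t ht
    obtain ⟨hot, hrt⟩ := frozen_tail hroot W hN hplat ho t ht
    have hpa := frozen_recipe hroot W t hot (hplat t (by omega)) (i := a) (by rw [hrt]; exact ha)
    have hpc := frozen_recipe hroot W t hot (hplat t (by omega)) (i := c) (by rw [hrt]; exact hc)
    exact ⟨hpa.1, hpc.1, hpa.2, hpc.2⟩
  refine LassoCut.no_axis_tail W (W.j t₀) t₀ fun t ht => ?_
  obtain ⟨hja, hjc, hba, hbc⟩ := hrec (t + 1) (by omega)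
  obtain ⟨hja₀, hjc₀, -, -⟩ := hrec t₀ le_rfl
  have hj : W.j (t + 1) = W.j t₀ := fin3_eq_of_ne_of_ne hac hja₀ hjc₀ hja hjc
  refine ⟨hj, funext fun i => ?_⟩
  rcases fin3_cases hac hja hjc i with h | h | h
  · rw [h, hba]; rfl
  · rw [h, hbc]; rfl
  · rw [h]; exact W.onExc (t + 1)

end Walks

end Summit.ResolutionOfSingularities.ResolutionOfSingularities.Theorems.ExitLaw
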